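import Literature.Geometry.ComplexHyperbolic.UnitBallLieAlgebraOrbitalDefs          -- ★ (a0) p846448: `torusH`, `rootProduct`, `lieOrbital`, `lieBasis`
import Literature.Geometry.ComplexHyperbolic.UnitBallRegularOrbitDRegimeBound        -- ★ p844060: `isCompact_setOf_norm_22_sq_le`; brings ★ (β-0) `vecMulVec_star_mul_J_apply`, ★ `UnitBallBounds`
import Literature.NumberTheory.Automorphic.ArchLocalTorusOrbitalBlockSmooth           -- ★ (A1): the GENERIC `contDiffAt_integral_comp_of_contDiff_of_support` (Hörmander after a cutoff)
import Literature.Analysis.Calculus.IteratedFDerivParametricIntegral                  -- ★ Hörmander: `iteratedFDeriv_integral_eq`, `continuous_iteratedFDeriv_comp_affine(_param)`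
import HarnessLib

/-!
# The orbital integral on the Lie algebra `𝔲(2,1)` is `C^∞` on the regular set of the torus, and its derivatives are computed UNDER the integral
# (ROAD «A6-IV» brick (a1); Warner II §8.4.1 «the integral defining `φ_f` is uniformly convergent in a neighbourhood of each point of `𝔧′`»; Hörmander Thm. 1.1.9)

Topic `Geometry/ComplexHyperbolic`; namespaces `Literature.Analysis.Calculus` (§1, generic) and `Literature.Geometry.ComplexHyperbolic.BallModel` (§2–§4).  THEOREMS ONLY (no `def`, no
instance, no notation, no axiom, no named fact, no `sorry`).  Cell `pub/hodgecm-mathlib`, ENGINE T1 (crux H413 = `stmt-HodgeConjecture-24833`); ROAD A, design of record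
`DESIGN-A6-InHouse-v2-ArchitectureIV` 93542b84 (LEAD T11-4), SPEC fb65bd65 (a1); author F0P3a-p05 (g15) (ROAD A owner), 2026-09-01.

THE MATHEMATICS (`G = U(2,1)` in the ball model; ★ (a0) currency).
* §1 (generic, the derivative twin of ★ `contDiffAt_integral_comp_of_contDiff_of_support`): `μ` finite on compacts, `Ψ : P × V → F` smooth, `y : Y → P` continuous, a compact `S ⊆ Y` and a
  neighbourhood `U ∋ X₀` with `Ψ(y t, X) = 0` for `t ∉ S`, `X ∈ U` ⇒ for every `n`, **`Dⁿ[X ↦ ∫ Ψ(y t, X) dμ](X₀) = ∫ Dⁿ[X ↦ Ψ(y t, X)](X₀) dμ`** (Hörmander ★ `iteratedFDeriv_integral_eq` after the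
  same cutoff; the cut and uncut functions agree near `X₀`).
* §2 THE SUPPORT IS UNIFORMLY COMPACT NEAR A REGULAR POINT: for ANY diagonal `D = diag(d)`, `x = mat g · D · mat g⁻¹` satisfies the signature-(2,1) Pythagoras of row 2 (Lie twin of ★ (c1)
  `norm_sq_row_two_signature`, same three lines): `(|g₂₂|² − 1)·min(|d₀−d₂|,|d₁−d₂|)² ≤ |x₂₀|² + |x₂₁|²`; hence if `f` vanishes off `{‖X‖ ≤ R}` and `min(|θ₀−θ₂|,|θ₁−θ₂|) ≥ m > 0` then
  `f(Ad_g torusH θ) ≠ 0 ⇒ |g₂₂|² ≤ 1 + 2R²∕m²` — a compact set of `g` (★ `isCompact_setOf_norm_22_sq_le`), uniformly for `θ` near a regular `θ₀`.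
* §3 `θ ↦ lieOrbital μ f (torusH θ)` is `C^∞` at every `θ₀` off the two NONCOMPACT walls (`θ₀ ≠ θ₂`, `θ₁ ≠ θ₂`; the compact wall `θ₀ = θ₁` is allowed — compact centraliser), and
  **`Dⁿ[θ ↦ lieOrbital μ f (torusH θ)](θ₀)(v₁,…,vₙ) = ∫_G Dⁿf(Ad_g torusH θ₀)[Ad_g torusH v₁, …, Ad_g torusH vₙ] dμ(g)`** (the section `θ ↦ f(Ad_g torusH θ)` is `f` along the LINEAR map
  `θ ↦ Ad_g torusH θ`, ★ `ContinuousLinearMap.iteratedFDeriv_comp_right`).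
Consumers: (b1) the flat Casimir identity (second derivatives + the IBP identity of (a1′)), (c3′) crude jet bounds (all orders), (d2).
HONEST LABEL: HC_CM is proved only modulo the printed citations until rung 0 closes; real analysis, pays nothing by itself.

## References
* [WarnerHASSLG2] G. Warner, *Harmonic Analysis on Semi-Simple Lie Groups II*, Grundlehren 189 (1972), §8.4.1 (uniform convergence of `φ_f` near points of `𝔧′`), §8.5.1.
* [HormanderALPDO1] L. Hörmander, *The Analysis of Linear Partial Differential Operators I*, 2nd ed. (1990), Thm. 1.1.9.
* [DeitmarEchterhoff2014] A. Deitmar, S. Echterhoff, *Principles of Harmonic Analysis*, 2nd ed. (2014), Lemma 9.3.3.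
-/

set_option autoImplicit false

noncomputable section

open MeasureTheory Measure Filter Topology Set Function Metric

open scoped ContDiff

/-! ## §1 Derivatives under the integral sign: uniform compact support near the base point, measure finite on compacts -/

namespace Literature.Analysis.Calculus

section Generic

variable {Y : Type*} [TopologicalSpace Y] [T2Space Y] [MeasurableSpace Y] [OpensMeasurableSpace Y]
  {P : Type*} [NormedAddCommGroup P] [NormedSpace ℝ P]
  {V : Type*} [NormedAddCommGroup V] [NormedSpace ℝ V] [FiniteDimensional ℝ V]
  {F : Type*} [NormedAddCommGroup F] [NormedSpace ℝ F] [CompleteSpace F]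

/-- **DERIVATIVES UNDER THE INTEGRAL SIGN, UNIFORM COMPACT SUPPORT** (the derivative twin of ★ `contDiffAt_integral_comp_of_contDiff_of_support`): `μ` finite on compacts, `Ψ : P × V → F`
smooth (`V` finite-dimensional), `y : Y → P` continuous; if there are a compact `S ⊆ Y` and a neighbourhood `U` of `X₀` with `Ψ(y t, X) = 0` for `t ∉ S`, `X ∈ U`, then for every `n`
`Dⁿ[X ↦ ∫_Y Ψ(y t, X) dμ(t)](X₀) = ∫_Y Dⁿ[X ↦ Ψ(y t, X)](X₀) dμ(t)`.  (Hörmander ★ `iteratedFDeriv_integral_eq` for the cut integrand `χ(X)•Ψ(y t, X)`, `χ = 1` near `X₀`,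
`tsupport χ ⊆ U`; cut and uncut functions agree near `X₀`, so do their iterated derivatives at `X₀`.) [cite: HormanderALPDO1, Thm. 1.1.9] [cite: DeitmarEchterhoff2014, Lemma 9.3.3] -/
theorem iteratedFDeriv_integral_comp_of_contDiff_of_support (μ : Measure Y) [IsFiniteMeasureOnCompacts μ] (Ψ : P × V → F) (hΨ : ContDiff ℝ ∞ Ψ) (y : Y → P) (hy : Continuous y)
    (X₀ : V) {S : Set Y} (hS : IsCompact S) {U : Set V} (hU : U ∈ 𝓝 X₀) (h0 : ∀ t ∉ S, ∀ X ∈ U, Ψ (y t, X) = 0) (n : ℕ) :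
    iteratedFDeriv ℝ n (fun X : V => ∫ t, Ψ (y t, X) ∂μ) X₀ = ∫ t, iteratedFDeriv ℝ n (fun X : V => Ψ (y t, X)) X₀ ∂μ := by
  -- a smooth compactly supported cutoff `χ = 1` near `X₀` with `tsupport χ ⊆ U` (Mathlib bump on the Euclidean model of `V`)
  set e : V ≃L[ℝ] EuclideanSpace ℝ (Fin (Module.finrank ℝ V)) := toEuclidean with he
  obtain ⟨ε, hε, hεU⟩ : ∃ ε > 0, Metric.closedBall (e X₀) ε ⊆ e.symm ⁻¹' U := by
    have hU' : e.symm ⁻¹' U ∈ 𝓝 (e X₀) := by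
      refine e.symm.continuous.continuousAt.preimage_mem_nhds ?_
      rw [ContinuousLinearEquiv.symm_apply_apply]; exact hU
    exact Metric.nhds_basis_closedBall.mem_iff.1 hU'
  let bump : ContDiffBump (e X₀) := ⟨ε / 2, ε, half_pos hε, half_lt_self hε⟩
  set χ : V → ℝ := fun X => bump (e X) with hχ
  have hχd : ContDiff ℝ ∞ χ := bump.contDiff.comp e.contDiff
  have hχc : HasCompactSupport χ := bump.hasCompactSupport.comp_homeomorph e.toHomeomorph
  have hχ1 : ∀ᶠ X in 𝓝 X₀, χ X = 1 := by
    have hev : ∀ᶠ X in 𝓝 X₀, e X ∈ Metric.closedBall (e X₀) (ε / 2) :=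
      e.continuous.continuousAt.eventually_mem (Metric.closedBall_mem_nhds _ (half_pos hε))
    exact hev.mono fun X hX => bump.one_of_mem_closedBall hX
  have hχU : ∀ X, χ X ≠ 0 → X ∈ U := by
    intro X hX
    have hXs : e X ∈ Metric.closedBall (e X₀) ε := bump.tsupport_eq ▸ subset_tsupport _ (Function.mem_support.2 hX)
    have := hεU hXs
    rwa [Set.mem_preimage, ContinuousLinearEquiv.symm_apply_apply] at this
  -- the cut integrand in the affine presentation `Ψχ (L X + c t)`
  set Ψχ : P × V → F := fun q => χ q.2 • Ψ q with hΨχ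
  have hΨχd : ContDiff ℝ ∞ Ψχ := (hχd.comp contDiff_snd).smul hΨ
  set L : V →L[ℝ] P × V := ContinuousLinearMap.inr ℝ P V with hL
  set c : Y → P × V := fun t => (y t, 0) with hc
  have hcc : Continuous c := hy.prodMk continuous_const
  have hLc : ∀ t X, L X + c t = (y t, X) := fun t X => by
    rw [hL, hc, ContinuousLinearMap.inr_apply, Prod.mk_add_mk, zero_add, add_zero]
  set H : Y → V → F := fun t X => Ψχ (L X + c t) with hH
  have hHeq : ∀ t, H t = fun X => χ X • Ψ (y t, X) := fun t => by funext X; rw [hH]; simp only [hΨχ, hLc]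
  -- off `S` the cut integrand vanishes identically, hence so do all its derivatives
  have hHS : ∀ t ∉ S, H t = 0 := by
    intro t ht; rw [hHeq t]; funext X
    by_cases hX : χ X = 0
    · rw [hX, zero_smul, Pi.zero_apply]
    · rw [h0 t ht X (hχU X hX), smul_zero, Pi.zero_apply]
  have hDS : ∀ (n : ℕ) (t : Y), t ∉ S → ∀ X, iteratedFDeriv ℝ n (H t) X = 0 := by
    intro n t ht X; rw [hHS t ht]; simp
  -- Hörmander's hypotheses
  have h1 : ∀ t, ContDiff ℝ ∞ (H t) := fun t => hΨχd.comp ((L.contDiff).add contDiff_const)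
  have h2 : ∀ (n : ℕ) (X : V), AEStronglyMeasurable (fun t => iteratedFDeriv ℝ n (H t) X) μ := fun n X =>
    ((continuous_iteratedFDeriv_comp_affine_param hΨχd L hcc n X).stronglyMeasurable_of_hasCompactSupport
      (HasCompactSupport.intro hS fun t ht => hDS n t ht X)).aestronglyMeasurable
  have h3 : ∀ n : ℕ, ∃ g : Y → ℝ, Integrable g μ ∧ ∀ t X, ‖iteratedFDeriv ℝ n (H t) X‖ ≤ g t := by
    intro n
    have hjc : Continuous fun q : Y × V => iteratedFDeriv ℝ n (fun X => Ψχ (L X + c q.1)) q.2 := continuous_iteratedFDeriv_comp_affine hΨχd L hcc n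
    obtain ⟨B, hB⟩ := (hS.prod hχc.isCompact).exists_bound_of_continuousOn (f := fun q : Y × V => iteratedFDeriv ℝ n (fun X => Ψχ (L X + c q.1)) q.2) hjc.continuousOn
    refine ⟨S.indicator fun _ => max B 0, ?_, fun t X => ?_⟩
    · exact (integrableOn_const (hS.measure_lt_top (μ := μ)).ne).integrable_indicator hS.measurableSet
    by_cases ht : t ∈ S
    · rw [Set.indicator_of_mem ht]
      by_cases hX : X ∈ tsupport χ
      · exact (hB (t, X) ⟨ht, hX⟩).trans (le_max_left _ _)
      · have hsupp : tsupport (H t) ⊆ tsupport χ := by rw [hHeq t]; exact tsupport_smul_subset_left _ _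
        have h0' : iteratedFDeriv ℝ n (H t) X = 0 := by
          by_contra hne
          exact hX (hsupp (support_iteratedFDeriv_subset n (Function.mem_support.2 hne)))
        rw [h0', norm_zero]; exact le_max_right _ _
    · rw [Set.indicator_of_notMem ht, hDS n t ht X, norm_zero]
  have hformula := iteratedFDeriv_integral_eq h1 h2 h3 n X₀
  -- near `X₀` the cut integral is the integral, and each cut section is the section
  have hcutI : (fun X => ∫ t, H t X ∂μ) =ᶠ[𝓝 X₀] fun X : V => ∫ t, Ψ (y t, X) ∂μ := by
    refine hχ1.mono fun X hX1 => ?_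
    refine integral_congr_ae (Eventually.of_forall fun t => ?_)
    simp only [hH, hΨχ, hLc, hX1, one_smul]
  have hcutS : ∀ t, (H t) =ᶠ[𝓝 X₀] fun X : V => Ψ (y t, X) := by
    intro t
    refine hχ1.mono fun X hX1 => ?_
    simp only [hH, hΨχ, hLc, hX1, one_smul]
  rw [← (hcutI.iteratedFDeriv ℝ n).eq_of_nhds, hformula]
  refine integral_congr_ae (Eventually.of_forall fun t => ?_)
  exact ((hcutS t).iteratedFDeriv ℝ n).eq_of_nhds

omit [T2Space Y] [MeasurableSpace Y] [OpensMeasurableSpace Y] [FiniteDimensional ℝ V] [CompleteSpace F] in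
/-- Continuity in the outer variable of the partial iterated derivatives of `X ↦ Ψ(y t, X)` (★ `continuous_iteratedFDeriv_comp_affine_param` in the `inr` presentation).
[cite: HormanderALPDO1, Thm. 1.1.9] -/
theorem continuous_iteratedFDeriv_comp_section (Ψ : P × V → F) (hΨ : ContDiff ℝ ∞ Ψ) (y : Y → P) (hy : Continuous y) (n : ℕ) (X₀ : V) :
    Continuous fun t : Y => iteratedFDeriv ℝ n (fun X : V => Ψ (y t, X)) X₀ := by
  have hc := continuous_iteratedFDeriv_comp_affine_param hΨ (ContinuousLinearMap.inr ℝ P V) (c := fun t : Y => (y t, (0 : V))) (hy.prodMk continuous_const) n X₀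
  have hfun : ∀ t : Y, (fun X : V => Ψ (ContinuousLinearMap.inr ℝ P V X + (y t, (0 : V)))) = fun X : V => Ψ (y t, X) := by
    intro t; funext X
    rw [ContinuousLinearMap.inr_apply, Prod.mk_add_mk, zero_add, add_zero]
  simp only [hfun] at hc
  exact hc

omit [T2Space Y] [FiniteDimensional ℝ V] [CompleteSpace F] in
/-- If moreover `Ψ(y t, X) = 0` for `t ∉ S` (`S` compact) and `X` near `X₀`, the partial iterated derivative at `X₀` is an integrable function of `t` for every measure finite on compacts
(continuous with support in `S`). [cite: HormanderALPDO1, Thm. 1.1.9] -/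
theorem integrable_iteratedFDeriv_comp_section_of_support [T2Space Y] (μ : Measure Y) [IsFiniteMeasureOnCompacts μ] (Ψ : P × V → F) (hΨ : ContDiff ℝ ∞ Ψ) (y : Y → P)
    (hy : Continuous y) (X₀ : V) {S : Set Y} (hS : IsCompact S) {U : Set V} (hU : U ∈ 𝓝 X₀) (h0 : ∀ t ∉ S, ∀ X ∈ U, Ψ (y t, X) = 0) (n : ℕ) :
    Integrable (fun t : Y => iteratedFDeriv ℝ n (fun X : V => Ψ (y t, X)) X₀) μ := by
  refine (continuous_iteratedFDeriv_comp_section Ψ hΨ y hy n X₀).integrable_of_hasCompactSupport (HasCompactSupport.intro hS fun t ht => ?_)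
  have hzero : (fun X : V => Ψ (y t, X)) =ᶠ[𝓝 X₀] fun _ => 0 := Filter.eventually_of_mem hU fun X hX => h0 t ht X hX
  rw [(hzero.iteratedFDeriv ℝ n).eq_of_nhds, iteratedFDeriv_fun_zero]
  rfl

end Generic

end Literature.Analysis.Calculus

namespace Literature.Geometry.ComplexHyperbolic

namespace BallModel

open Matrix Complex ComplexConjugate MulAction Literature.Analysis.Calculus
open scoped Matrix.Norms.Operator

/-! ## §2 Uniform compact support of the orbital integrand near a regular point of the torus -/

section Support

/-- **SPECTRAL FORM OF THE CONJUGATE OF ANY DIAGONAL**: `mat g · diag(d) · mat g⁻¹ = Σ_p (d_p J_{pp}) • N(c_p(g))`, `N(w) = w w* J` (the ★ (β-0) form `mat_conj_diagonal_eq_sum`, now for an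
arbitrary diagonal `d : Fin 3 → ℂ` — e.g. `torusH θ`). [cite: WarnerHASSLG2, §8.4.1] -/
theorem conj_diagonal_eq_sum (g : U21) (d : Fin 3 → ℂ) :
    mat g * Matrix.diagonal d * mat g⁻¹ = ∑ p : Fin 3, (d p * J p p) • (vecMulVec (fun j => mat g j p) (star fun j => mat g j p) * J) := by
  rw [mat_inv g]
  ext i k
  rw [Matrix.sum_apply]
  simp only [Matrix.smul_apply, smul_eq_mul, vecMulVec_star_mul_J_apply]
  rw [show mat g * Matrix.diagonal d * (J * (mat g)ᴴ * J) = (mat g * Matrix.diagonal d * J) * (mat g)ᴴ * J by simp only [Matrix.mul_assoc]]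
  rw [J, Matrix.mul_diagonal, Matrix.mul_apply]
  simp only [Matrix.mul_diagonal, Matrix.conjTranspose_apply, Complex.star_def, Finset.sum_mul]
  refine Finset.sum_congr rfl fun p _ => ?_
  rw [Matrix.diagonal_apply_eq, Matrix.diagonal_apply_eq]
  ring

/-- Row 2 of `mat g·diag(d)·mat g⁻¹ − d₂·1` through the positive columns (Lie twin of ★ `mat_conj_diagonal_apply_two_sub`). [cite: WarnerHASSLG2, §8.4.3] -/
theorem conj_diagonal_apply_two_sub (g : U21) (d : Fin 3 → ℂ) (j : Fin 3) :
    (mat g * Matrix.diagonal d * mat g⁻¹) 2 j - d 2 * (1 : Matrix (Fin 3) (Fin 3) ℂ) 2 j =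
      ((d 0 - d 2) * mat g 2 0 * conj (mat g j 0) + (d 1 - d 2) * mat g 2 1 * conj (mat g j 1)) * J j j := by
  have hx : (mat g * Matrix.diagonal d * mat g⁻¹) 2 j = ∑ p : Fin 3, d p * J p p * (mat g 2 p * conj (mat g j p) * J j j) := by
    rw [conj_diagonal_eq_sum, Matrix.sum_apply]
    refine Finset.sum_congr rfl fun p _ => ?_
    rw [Matrix.smul_apply, smul_eq_mul, vecMulVec_star_mul_J_apply]
  have h1 : (1 : Matrix (Fin 3) (Fin 3) ℂ) 2 j = ∑ p : Fin 3, J p p * (mat g 2 p * conj (mat g j p) * J j j) := by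
    rw [← sum_J_smul_vecMulVec_matCol_eq_one g, Matrix.sum_apply]
    refine Finset.sum_congr rfl fun p _ => ?_
    rw [Matrix.smul_apply, smul_eq_mul, vecMulVec_star_mul_J_apply]
  rw [hx, h1, Fin.sum_univ_three, Fin.sum_univ_three, J_apply_00, J_apply_11, J_apply_22]
  ring

/-- `|α·u + β·v|² = |α|²|u|² + |β|²|v|² + 2·Re(α·β̄·u·v̄)` in `ℂ`. [folklore] -/
private theorem norm_sq_mul_add_mul' (α β u v : ℂ) :
    ‖α * u + β * v‖ ^ 2 = ‖α‖ ^ 2 * ‖u‖ ^ 2 + ‖β‖ ^ 2 * ‖v‖ ^ 2 + 2 * (α * conj β * (u * conj v)).re := by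
  simp only [Complex.sq_norm, Complex.normSq_apply, Complex.add_re, Complex.add_im, Complex.mul_re, Complex.mul_im, Complex.conj_re, Complex.conj_im]
  ring

/-- **THE ALL-REGIME SUPPORT INEQUALITY FOR ANY DIAGONAL**: `x = mat g·diag(d)·mat g⁻¹` satisfies `(|g₂₂|² − 1)·min(|d₀−d₂|,|d₁−d₂|)² ≤ |x₂₀|² + |x₂₁|²` (Lie twin of ★ (c1)
`norm_22_sq_sub_one_mul_min_sq_le`: the `J`-norm of row 2 of `x − d₂·1` is `|d₀−d₂|²|g₂₀|² + |d₁−d₂|²|g₂₁|²`). [cite: WarnerHASSLG2, §8.4.3 Appendix Lemma 2] -/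
theorem norm_22_sq_sub_one_mul_min_sq_le_conj_diagonal (g : U21) (d : Fin 3 → ℂ) :
    (‖mat g 2 2‖ ^ 2 - 1) * (min ‖d 0 - d 2‖ ‖d 1 - d 2‖) ^ 2 ≤
      ‖(mat g * Matrix.diagonal d * mat g⁻¹) 2 0‖ ^ 2 + ‖(mat g * Matrix.diagonal d * mat g⁻¹) 2 1‖ ^ 2 := by
  -- row 2 in terms of `a = (d₀−d₂)g₂₀`, `b = (d₁−d₂)g₂₁`
  have h0 : (mat g * Matrix.diagonal d * mat g⁻¹) 2 0 = conj (conj ((d 0 - d 2) * mat g 2 0) * mat g 0 0 + conj ((d 1 - d 2) * mat g 2 1) * mat g 0 1) := by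
    have h := conj_diagonal_apply_two_sub g d 0
    rw [Matrix.one_apply_ne (by decide : (2 : Fin 3) ≠ 0), mul_zero, sub_zero, J_apply_00, mul_one] at h
    rw [h]; simp only [map_add, map_mul, map_sub, Complex.conj_conj]
  have h1 : (mat g * Matrix.diagonal d * mat g⁻¹) 2 1 = conj (conj ((d 0 - d 2) * mat g 2 0) * mat g 1 0 + conj ((d 1 - d 2) * mat g 2 1) * mat g 1 1) := by
    have h := conj_diagonal_apply_two_sub g d 1
    rw [Matrix.one_apply_ne (by decide : (2 : Fin 3) ≠ 1), mul_zero, sub_zero, J_apply_11, mul_one] at h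
    rw [h]; simp only [map_add, map_mul, map_sub, Complex.conj_conj]
  -- column facts
  have hc0 : ‖mat g 0 0‖ ^ 2 + ‖mat g 1 0‖ ^ 2 - ‖mat g 2 0‖ ^ 2 = 1 := by simpa using col_identity g 0
  have hc1 : ‖mat g 0 1‖ ^ 2 + ‖mat g 1 1‖ ^ 2 - ‖mat g 2 1‖ ^ 2 = 1 := by simpa using col_identity g 1
  have hS : mat g 0 0 * conj (mat g 0 1) + mat g 1 0 * conj (mat g 1 1) - mat g 2 0 * conj (mat g 2 1) = 0 := by
    have h := congrFun (congrFun (mat_mem g) 1) 0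
    rw [J_apply_of_ne (by decide : (1 : Fin 3) ≠ 0)] at h
    simp only [Matrix.mul_apply, Fin.sum_univ_three, Matrix.conjTranspose_apply, Complex.star_def, J_apply_00, J_apply_11, J_apply_22,
      J_apply_of_ne (by decide : (0 : Fin 3) ≠ 1), J_apply_of_ne (by decide : (0 : Fin 3) ≠ 2), J_apply_of_ne (by decide : (1 : Fin 3) ≠ 0),
      J_apply_of_ne (by decide : (1 : Fin 3) ≠ 2), J_apply_of_ne (by decide : (2 : Fin 3) ≠ 0), J_apply_of_ne (by decide : (2 : Fin 3) ≠ 1)] at h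
    linear_combination h
  have hrow := norm_sq_two_zero_add_norm_sq_two_one g
  set α : ℂ := conj ((d 0 - d 2) * mat g 2 0) with hα
  set β : ℂ := conj ((d 1 - d 2) * mat g 2 1) with hβ
  have hre : (α * conj β * (mat g 0 0 * conj (mat g 0 1))).re + (α * conj β * (mat g 1 0 * conj (mat g 1 1))).re
      - (α * conj β * (mat g 2 0 * conj (mat g 2 1))).re = 0 := by
    rw [← Complex.add_re, ← Complex.sub_re, ← mul_add, ← mul_sub, hS, mul_zero, Complex.zero_re]
  have hsig : ‖(mat g * Matrix.diagonal d * mat g⁻¹) 2 0‖ ^ 2 + ‖(mat g * Matrix.diagonal d * mat g⁻¹) 2 1‖ ^ 2 ≥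
      ‖d 0 - d 2‖ ^ 2 * ‖mat g 2 0‖ ^ 2 + ‖d 1 - d 2‖ ^ 2 * ‖mat g 2 1‖ ^ 2 := by
    have hαn : ‖α‖ ^ 2 = ‖d 0 - d 2‖ ^ 2 * ‖mat g 2 0‖ ^ 2 := by rw [hα, Complex.norm_conj, norm_mul, mul_pow]
    have hβn : ‖β‖ ^ 2 = ‖d 1 - d 2‖ ^ 2 * ‖mat g 2 1‖ ^ 2 := by rw [hβ, Complex.norm_conj, norm_mul, mul_pow]
    rw [h0, h1, Complex.norm_conj, Complex.norm_conj, norm_sq_mul_add_mul', norm_sq_mul_add_mul', ← hαn, ← hβn]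
    nlinarith [hc0, hc1, hre, norm_sq_mul_add_mul' α β (mat g 2 0) (mat g 2 1), norm_nonneg (α * mat g 2 0 + β * mat g 2 1), sq_nonneg ‖α * mat g 2 0 + β * mat g 2 1‖,
      sq_nonneg ‖α‖, sq_nonneg ‖β‖]
  set m : ℝ := min ‖d 0 - d 2‖ ‖d 1 - d 2‖ with hm
  have hm0 : 0 ≤ m := le_min (norm_nonneg _) (norm_nonneg _)
  have hma : m ^ 2 ≤ ‖d 0 - d 2‖ ^ 2 := pow_le_pow_left₀ hm0 (min_le_left _ _) 2
  have hmb : m ^ 2 ≤ ‖d 1 - d 2‖ ^ 2 := pow_le_pow_left₀ hm0 (min_le_right _ _) 2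
  have e1 : m ^ 2 * ‖mat g 2 0‖ ^ 2 ≤ ‖d 0 - d 2‖ ^ 2 * ‖mat g 2 0‖ ^ 2 := mul_le_mul_of_nonneg_right hma (sq_nonneg _)
  have e2 : m ^ 2 * ‖mat g 2 1‖ ^ 2 ≤ ‖d 1 - d 2‖ ^ 2 * ‖mat g 2 1‖ ^ 2 := mul_le_mul_of_nonneg_right hmb (sq_nonneg _)
  nlinarith [e1, e2, hsig, hrow]

/-- An entry is bounded by the `L^∞`-operator norm: `|X_{ij}| ≤ ‖X‖`. [cite: HormanderALPDO1, Thm. 1.1.9] -/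
theorem norm_apply_le_norm_matrix (X : Matrix (Fin 3) (Fin 3) ℂ) (i j : Fin 3) : ‖X i j‖ ≤ ‖X‖ := by
  have h : ‖X i j‖₊ ≤ ‖X‖₊ := by
    rw [Matrix.linfty_opNNNorm_def]
    exact le_trans (Finset.single_le_sum (f := fun j => ‖X i j‖₊) (fun _ _ => bot_le) (Finset.mem_univ j)) (Finset.le_sup (f := fun i => ∑ j, ‖X i j‖₊) (Finset.mem_univ i))
  exact_mod_cast h

/-- **SUPPORT CONFINEMENT AT THE LIE-ALGEBRA LEVEL, ALL REGIMES**: if `f` vanishes off `{‖X‖ ≤ R}` (`0 ≤ R`) and `0 < m ≤ min(|θ₀−θ₂|,|θ₁−θ₂|)`, then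
`f(mat g · torusH θ · mat g⁻¹) ≠ 0 ⇒ |g₂₂|² ≤ 1 + 2R²∕m²`. [cite: WarnerHASSLG2, §8.4.3 Appendix Lemma 2] -/
theorem norm_22_sq_le_of_apply_conj_torusH_ne_zero {E : Type*} [NormedAddCommGroup E] {f : Matrix (Fin 3) (Fin 3) ℂ → E} {R : ℝ}
    (hfR : ∀ X, f X ≠ 0 → ‖X‖ ≤ R) {m : ℝ} (hm : 0 < m) (θ : Fin 3 → ℝ)
    (hmθ : m ≤ min |θ 0 - θ 2| |θ 1 - θ 2|) (g : U21) (hg : f (mat g * torusH θ * mat g⁻¹) ≠ 0) :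
    ‖mat g 2 2‖ ^ 2 ≤ 1 + 2 * R ^ 2 / m ^ 2 := by
  have hX := hfR _ hg
  have hR : 0 ≤ R := le_trans (norm_nonneg _) hX
  set d : Fin 3 → ℂ := fun k => ((θ k : ℝ) : ℂ) * I with hd
  have hD : torusH θ = Matrix.diagonal d := rfl
  rw [hD] at hX
  have h := norm_22_sq_sub_one_mul_min_sq_le_conj_diagonal g d
  have hdiff : ∀ k l : Fin 3, ‖d k - d l‖ = |θ k - θ l| := by
    intro k l
    rw [hd]
    simp only
    rw [← sub_mul, norm_mul, Complex.norm_I, mul_one, ← Complex.ofReal_sub, Complex.norm_real, Real.norm_eq_abs]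
  rw [hdiff, hdiff] at h
  have h20 : ‖(mat g * Matrix.diagonal d * mat g⁻¹) 2 0‖ ^ 2 ≤ R ^ 2 := pow_le_pow_left₀ (norm_nonneg _) ((norm_apply_le_norm_matrix _ 2 0).trans hX) 2
  have h21 : ‖(mat g * Matrix.diagonal d * mat g⁻¹) 2 1‖ ^ 2 ≤ R ^ 2 := pow_le_pow_left₀ (norm_nonneg _) ((norm_apply_le_norm_matrix _ 2 1).trans hX) 2
  have hpos : 0 ≤ ‖mat g 2 2‖ ^ 2 - 1 := by nlinarith [one_le_norm_22 g, norm_nonneg (mat g 2 2)]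
  have hmm : m ^ 2 ≤ (min |θ 0 - θ 2| |θ 1 - θ 2|) ^ 2 := pow_le_pow_left₀ hm.le hmθ 2
  have h1 : (‖mat g 2 2‖ ^ 2 - 1) * m ^ 2 ≤ 2 * R ^ 2 := le_trans (mul_le_mul_of_nonneg_left hmm hpos) (by linarith)
  have h2 : ‖mat g 2 2‖ ^ 2 - 1 ≤ 2 * R ^ 2 / m ^ 2 := (le_div_iff₀ (pow_pos hm 2)).2 h1
  linarith

/-- **UNIFORM COMPACT SUPPORT NEAR A POINT OFF THE NONCOMPACT WALLS**: if `f` has compact support and `θ₀ 0 ≠ θ₀ 2`, `θ₀ 1 ≠ θ₀ 2`, there are a compact `S ⊆ G` and a neighbourhood `U ∋ θ₀` with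
`f(mat g · torusH θ · mat g⁻¹) = 0` for all `g ∉ S`, `θ ∈ U`. [cite: WarnerHASSLG2, §8.4.1] [cite: DeitmarEchterhoff2014, Lemma 9.3.3] -/
theorem exists_isCompact_apply_conj_torusH_eq_zero {E : Type*} [NormedAddCommGroup E] {f : Matrix (Fin 3) (Fin 3) ℂ → E} (hfc : HasCompactSupport f)
    (θ₀ : Fin 3 → ℝ) (h02 : θ₀ 0 ≠ θ₀ 2) (h12 : θ₀ 1 ≠ θ₀ 2) :
    ∃ (S : Set U21) (U : Set (Fin 3 → ℝ)), IsCompact S ∧ U ∈ 𝓝 θ₀ ∧ ∀ g ∉ S, ∀ θ ∈ U, f (mat g * torusH θ * mat g⁻¹) = 0 := by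
  -- a radius for the support of `f`
  obtain ⟨R, hR⟩ : ∃ R : ℝ, ∀ X, f X ≠ 0 → ‖X‖ ≤ R := by
    obtain ⟨R, hR⟩ := hfc.isCompact.isBounded.subset_closedBall 0
    exact ⟨R, fun X hX => by simpa using hR (subset_tsupport _ (Function.mem_support.2 hX))⟩
  -- the noncompact root moduli stay `≥ m₀∕2` near `θ₀`
  set m₀ : ℝ := min |θ₀ 0 - θ₀ 2| |θ₀ 1 - θ₀ 2| with hm₀
  have hm₀pos : 0 < m₀ := lt_min (abs_pos.2 (sub_ne_zero.2 h02)) (abs_pos.2 (sub_ne_zero.2 h12))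
  set U : Set (Fin 3 → ℝ) := Metric.ball θ₀ (m₀ / 4) with hU
  have hUn : U ∈ 𝓝 θ₀ := Metric.ball_mem_nhds _ (by positivity)
  have hmU : ∀ θ ∈ U, m₀ / 2 ≤ min |θ 0 - θ 2| |θ 1 - θ 2| := by
    intro θ hθ
    rw [hU, Metric.mem_ball, dist_pi_lt_iff (by positivity)] at hθ
    have e0 := hθ 0; have e1 := hθ 1; have e2 := hθ 2
    rw [Real.dist_eq] at e0 e1 e2
    have a0 : |θ₀ 0 - θ₀ 2| ≤ |θ 0 - θ 2| + m₀ / 2 := by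
      calc |θ₀ 0 - θ₀ 2| = |(θ 0 - θ 2) - ((θ 0 - θ₀ 0) - (θ 2 - θ₀ 2))| := by ring_nf
        _ ≤ |θ 0 - θ 2| + |(θ 0 - θ₀ 0) - (θ 2 - θ₀ 2)| := abs_sub _ _
        _ ≤ |θ 0 - θ 2| + (|θ 0 - θ₀ 0| + |θ 2 - θ₀ 2|) := by gcongr; exact abs_sub _ _
        _ ≤ |θ 0 - θ 2| + m₀ / 2 := by linarith
    have a1 : |θ₀ 1 - θ₀ 2| ≤ |θ 1 - θ 2| + m₀ / 2 := by
      calc |θ₀ 1 - θ₀ 2| = |(θ 1 - θ 2) - ((θ 1 - θ₀ 1) - (θ 2 - θ₀ 2))| := by ring_nf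
        _ ≤ |θ 1 - θ 2| + |(θ 1 - θ₀ 1) - (θ 2 - θ₀ 2)| := abs_sub _ _
        _ ≤ |θ 1 - θ 2| + (|θ 1 - θ₀ 1| + |θ 2 - θ₀ 2|) := by gcongr; exact abs_sub _ _
        _ ≤ |θ 1 - θ 2| + m₀ / 2 := by linarith
    have b0 : m₀ ≤ |θ₀ 0 - θ₀ 2| := min_le_left _ _
    have b1 : m₀ ≤ |θ₀ 1 - θ₀ 2| := min_le_right _ _
    exact le_min (by linarith) (by linarith)
  refine ⟨{g : U21 | ‖mat g 2 2‖ ^ 2 ≤ 1 + 2 * R ^ 2 / (m₀ / 2) ^ 2}, U, isCompact_setOf_norm_22_sq_le (by positivity), hUn, fun g hg θ hθ => ?_⟩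
  by_contra hne
  exact hg (norm_22_sq_le_of_apply_conj_torusH_ne_zero hR (by positivity) θ (hmU θ hθ) g hne)

end Support

/-! ## §3 Smoothness and derivatives of the Lie-algebra orbital integral off the noncompact walls -/

section Smooth

variable {E : Type*} [NormedAddCommGroup E] [NormedSpace ℝ E] [CompleteSpace E]

/-- `torusH` is smooth (it is linear). [cite: WarnerHASSLG2, §8.4.1] -/
theorem contDiff_torusH : ContDiff ℝ ∞ torusH := by
  let Tₗ : (Fin 3 → ℝ) →ₗ[ℝ] Matrix (Fin 3) (Fin 3) ℂ :=
    { toFun := torusH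
      map_add' := fun θ θ' => torusH_add θ θ'
      map_smul' := fun c θ => by rw [torusH_smul, RingHom.id_apply, Complex.coe_smul] }
  have h : (torusH : (Fin 3 → ℝ) → Matrix (Fin 3) (Fin 3) ℂ) = ⇑(LinearMap.toContinuousLinearMap Tₗ) := rfl
  rw [h]
  exact (LinearMap.toContinuousLinearMap Tₗ).contDiff

omit [CompleteSpace E] in
/-- The integrand `((A,B), θ) ↦ f(A · torusH θ · B)` is jointly smooth. [cite: HormanderALPDO1, Thm. 1.1.9] -/
theorem contDiff_apply_mul_torusH_mul {f : Matrix (Fin 3) (Fin 3) ℂ → E} (hf : ContDiff ℝ ∞ f) :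
    ContDiff ℝ ∞ fun q : (Matrix (Fin 3) (Fin 3) ℂ × Matrix (Fin 3) (Fin 3) ℂ) × (Fin 3 → ℝ) => f (q.1.1 * torusH q.2 * q.1.2) :=
  hf.comp (((contDiff_fst.comp contDiff_fst).mul (contDiff_torusH.comp contDiff_snd)).mul (contDiff_snd.comp contDiff_fst))

omit [NormedSpace ℝ E] [CompleteSpace E] in
/-- `g ↦ (mat g, mat g⁻¹)` is continuous. [cite: HormanderALPDO1, Thm. 1.1.9] -/
theorem continuous_mat_prod_mat_inv : Continuous fun g : U21 => (mat g, mat g⁻¹) :=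
  continuous_mat.prodMk (continuous_mat.comp continuous_inv)

/-- **THE LIE-ALGEBRA ORBITAL INTEGRAL IS `C^∞` OFF THE NONCOMPACT WALLS**: for `f ∈ C_c^∞(M₃(ℂ))` and `θ₀ 0 ≠ θ₀ 2`, `θ₀ 1 ≠ θ₀ 2`, `θ ↦ lieOrbital μ f (torusH θ)` is `C^∞` at `θ₀` (★ generic
`contDiffAt_integral_comp_of_contDiff_of_support` on the uniform compact support of §2). [cite: WarnerHASSLG2, §8.4.1] [cite: HormanderALPDO1, Thm. 1.1.9] -/
theorem contDiffAt_lieOrbital_torusH (μ : Measure U21) [IsFiniteMeasureOnCompacts μ] {f : Matrix (Fin 3) (Fin 3) ℂ → E} (hf : ContDiff ℝ ∞ f) (hfc : HasCompactSupport f)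
    (θ₀ : Fin 3 → ℝ) (h02 : θ₀ 0 ≠ θ₀ 2) (h12 : θ₀ 1 ≠ θ₀ 2) :
    ContDiffAt ℝ ∞ (fun θ : Fin 3 → ℝ => lieOrbital μ f (torusH θ)) θ₀ := by
  obtain ⟨S, U, hS, hU, h0⟩ := exists_isCompact_apply_conj_torusH_eq_zero hfc θ₀ h02 h12
  have h := contDiffAt_integral_comp_of_contDiff_of_support μ (fun q : (Matrix (Fin 3) (Fin 3) ℂ × Matrix (Fin 3) (Fin 3) ℂ) × (Fin 3 → ℝ) => f (q.1.1 * torusH q.2 * q.1.2))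
    (contDiff_apply_mul_torusH_mul hf) (fun g : U21 => (mat g, mat g⁻¹)) continuous_mat_prod_mat_inv θ₀ hS hU (fun g hg θ hθ => h0 g hg θ hθ)
  simpa only [lieOrbital] using h

omit [CompleteSpace E] in
/-- The section `θ ↦ f(mat g · torusH θ · mat g⁻¹)` is `f` along a LINEAR map, so its iterated derivative is `Dⁿf(Ad_g torusH θ)[Ad_g torusH v₁, …]`.
[cite: HormanderALPDO1, Thm. 1.1.9] -/
theorem iteratedFDeriv_apply_conj_torusH {f : Matrix (Fin 3) (Fin 3) ℂ → E} (hf : ContDiff ℝ ∞ f) (g : U21) (n : ℕ) (θ : Fin 3 → ℝ) (v : Fin n → (Fin 3 → ℝ)) :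
    iteratedFDeriv ℝ n (fun θ : Fin 3 → ℝ => f (mat g * torusH θ * mat g⁻¹)) θ v = iteratedFDeriv ℝ n f (mat g * torusH θ * mat g⁻¹) (fun i => mat g * torusH (v i) * mat g⁻¹) := by
  -- the linear map `θ ↦ Ad_g torusH θ`
  let Lₗ : (Fin 3 → ℝ) →ₗ[ℝ] Matrix (Fin 3) (Fin 3) ℂ :=
    { toFun := fun θ => mat g * torusH θ * mat g⁻¹
      map_add' := fun θ θ' => by simp only [torusH_add, Matrix.mul_add, Matrix.add_mul]
      map_smul' := fun c θ => by
        simp only [torusH_smul, RingHom.id_apply]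
        rw [Matrix.mul_smul, Matrix.smul_mul, Complex.coe_smul] }
  let L : (Fin 3 → ℝ) →L[ℝ] Matrix (Fin 3) (Fin 3) ℂ := LinearMap.toContinuousLinearMap Lₗ
  have hL : ∀ θ', L θ' = mat g * torusH θ' * mat g⁻¹ := fun _ => rfl
  have hcomp : (fun θ : Fin 3 → ℝ => f (mat g * torusH θ * mat g⁻¹)) = f ∘ L := by funext θ'; simp only [Function.comp_apply, hL]
  have key : iteratedFDeriv ℝ n (f ∘ ⇑L) θ = (iteratedFDeriv ℝ n f (L θ)).compContinuousLinearMap fun _ => L :=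
    L.iteratedFDeriv_comp_right hf θ (by exact_mod_cast le_top)
  rw [hcomp]
  have key' := congrArg (fun T : ContinuousMultilinearMap ℝ (fun _ : Fin n => Fin 3 → ℝ) E => T v) key
  rw [key', ContinuousMultilinearMap.compContinuousLinearMap_apply]
  rfl

/-- **DERIVATIVES OF THE LIE-ALGEBRA ORBITAL INTEGRAL UNDER THE INTEGRAL SIGN** (all orders): for `f ∈ C_c^∞(M₃(ℂ))` and `θ₀` off the noncompact walls,
`Dⁿ[θ ↦ lieOrbital μ f (torusH θ)](θ₀)(v) = ∫_G Dⁿf(Ad_g torusH θ₀)[Ad_g torusH v₁, …, Ad_g torusH vₙ] dμ(g)`. [cite: WarnerHASSLG2, §8.4.1] [cite: HormanderALPDO1, Thm. 1.1.9] -/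
theorem iteratedFDeriv_lieOrbital_torusH_apply (μ : Measure U21) [IsFiniteMeasureOnCompacts μ] {f : Matrix (Fin 3) (Fin 3) ℂ → E} (hf : ContDiff ℝ ∞ f) (hfc : HasCompactSupport f)
    (θ₀ : Fin 3 → ℝ) (h02 : θ₀ 0 ≠ θ₀ 2) (h12 : θ₀ 1 ≠ θ₀ 2) (n : ℕ) (v : Fin n → (Fin 3 → ℝ)) :
    iteratedFDeriv ℝ n (fun θ : Fin 3 → ℝ => lieOrbital μ f (torusH θ)) θ₀ v =
      ∫ g, iteratedFDeriv ℝ n f (mat g * torusH θ₀ * mat g⁻¹) (fun i => mat g * torusH (v i) * mat g⁻¹) ∂μ := by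
  obtain ⟨S, U, hS, hU, h0⟩ := exists_isCompact_apply_conj_torusH_eq_zero hfc θ₀ h02 h12
  have h := iteratedFDeriv_integral_comp_of_contDiff_of_support μ (fun q : (Matrix (Fin 3) (Fin 3) ℂ × Matrix (Fin 3) (Fin 3) ℂ) × (Fin 3 → ℝ) => f (q.1.1 * torusH q.2 * q.1.2))
    (contDiff_apply_mul_torusH_mul hf) (fun g : U21 => (mat g, mat g⁻¹)) continuous_mat_prod_mat_inv θ₀ hS hU (fun g hg θ hθ => h0 g hg θ hθ) n
  have h' : iteratedFDeriv ℝ n (fun θ : Fin 3 → ℝ => lieOrbital μ f (torusH θ)) θ₀ = ∫ g, iteratedFDeriv ℝ n (fun θ : Fin 3 → ℝ => f (mat g * torusH θ * mat g⁻¹)) θ₀ ∂μ := by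
    simpa only [lieOrbital] using h
  rw [h']
  -- evaluate the multilinear-map-valued integral at `v`, then use the linear section
  have hint : Integrable (fun g => iteratedFDeriv ℝ n (fun θ : Fin 3 → ℝ => f (mat g * torusH θ * mat g⁻¹)) θ₀) μ :=
    integrable_iteratedFDeriv_comp_section_of_support μ (fun q : (Matrix (Fin 3) (Fin 3) ℂ × Matrix (Fin 3) (Fin 3) ℂ) × (Fin 3 → ℝ) => f (q.1.1 * torusH q.2 * q.1.2))
      (contDiff_apply_mul_torusH_mul hf) (fun g : U21 => (mat g, mat g⁻¹)) continuous_mat_prod_mat_inv θ₀ hS hU (fun g hg θ hθ => h0 g hg θ hθ) n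
  rw [ContinuousMultilinearMap.integral_apply hint v]
  refine integral_congr_ae (Eventually.of_forall fun g => ?_)
  exact iteratedFDeriv_apply_conj_torusH hf g n θ₀ v

end Smooth

end BallModel

end Literature.Geometry.ComplexHyperbolic

end
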